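import Literature.RingTheory.FormalGroups.FormalOModuleKernelIdeal
import Literature.RingTheory.FormalGroups.NilpotentEvaluation
import HarnessLib

/-!
# `[ϖ^m]_F(x) = 0 ↔ x^{q^{hm}} = 0` on nilpotent points, for a formal `𝒪`-module law of height `h`
# ([Harris–Taylor 2001] §II.1 p. 59; P6d sub-line `F0_P6d_FormalModuleKernels`, letter (HL-C))

Topic `Literature/RingTheory/FormalGroups`; namespace `Literature.RingTheory.FormalGroups`.  THEOREMS ONLY (no definition, no named fact,
no instance, no notation, no `sorry`).  Cell `hodgecm-mathlib`, P6 «MOD programme» ROW 4B, desk F0P6d-plan (g0) sub-line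
`Cruxes/HLiu418/Lines/F0_P6d_FormalModuleKernels.lean` letter (HL-C) `KernelPointsOfHeight` — the functor-of-points form of (HL-B) (★
`FormalOModuleLaw.kernelIdealOfHeight`, p844621): over ★ `NilpotentEvaluation` (`evalNilp`, by `rfl` the line's inline text) and ★
`exists_isUnit_act_pow_eq_X_pow_mul` («`[ϖ^m]_F = X^{q^{hm}}·w`, `w ∈ A⟦X⟧ˣ`»): `[ϖ^m]_F(x) = x^{q^{hm}} · w(x)` with `w(x)` a unit.

## Contents

* `FormalOModuleLaw.evalNilp_act_pow_eq` — `[ϖ^m]_F(x) = x^{q^{hm}} · w(x)` for the unit `w` of (HL-B).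
* **`FormalOModuleLaw.kernelPointsOfHeight`** = letter (HL-C) token for token (modulo the `rfl`-identical `evalNilp`):
  `∀ 𝒪 A M ϖ q h, 0 < q → M.IsOfHeight ϖ q h → ∀ m R x, IsNilpotent x → ([ϖ^m]_F(x) = 0 ↔ x^{q^{hm}} = 0)`.
-/

noncomputable section

namespace Literature.RingTheory.FormalGroups

universe u v

namespace FormalOModuleLaw

/-- `[ϖ^m]_F(x) = x^{q^{hm}} · w(x)` with `w(x)` a UNIT, at a nilpotent `x` of any `A`-algebra. [cite: HarrisTaylorAMS2001, §II.1 p. 59] -/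
theorem exists_isUnit_evalNilp_act_pow_eq {𝒪 : Type u} [CommRing 𝒪] {A : Type v} [CommRing A] [Algebra 𝒪 A] {M : FormalOModuleLaw 𝒪 A}
    {ϖ : 𝒪} {q h : ℕ} (hq : 0 < q) (hM : M.IsOfHeight ϖ q h) (m : ℕ) {R : Type v} [CommRing R] [Algebra A R] {x : R} (hx : IsNilpotent x) :
    ∃ c : R, IsUnit c ∧ evalNilp (M.act (ϖ ^ m)).toPowerSeries x = x ^ (q ^ (h * m)) * c := by
  obtain ⟨w, hw, hm⟩ := exists_isUnit_act_pow_eq_X_pow_mul hq hM m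
  exact ⟨evalNilp w x, isUnit_evalNilp hx (PowerSeries.isUnit_iff_constantCoeff.mp hw), by rw [hm, evalNilp_X_pow_mul hx]⟩

/-- **Letter (HL-C) `KernelPointsOfHeight` of the P6d sub-line `F0_P6d_FormalModuleKernels`**: for a formal `𝒪`-module law of height `h`
(normal form `[ϖ]_F = u(T^{q^h})`), a nilpotent `x` of an `A`-algebra `R` satisfies `[ϖ^m]_F(x) = 0 ↔ x^{q^{hm}} = 0`.
[cite: HarrisTaylorAMS2001, §II.1 p. 59] -/
theorem kernelPointsOfHeight :
    ∀ (𝒪 : Type u) [CommRing 𝒪] (A : Type v) [CommRing A] [Algebra 𝒪 A] (M : FormalOModuleLaw 𝒪 A) (ϖ : 𝒪) (q h : ℕ),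
      0 < q → M.IsOfHeight ϖ q h →
        ∀ (m : ℕ) (R : Type v) [CommRing R] [Algebra A R] (x : R), IsNilpotent x →
          (evalNilp (M.act (ϖ ^ m)).toPowerSeries x = 0 ↔ x ^ (q ^ (h * m)) = 0) := by
  intro 𝒪 _ A _ _ M ϖ q h hq hM m R _ _ x hx
  obtain ⟨c, hc, hm⟩ := exists_isUnit_evalNilp_act_pow_eq hq hM m hx
  rw [hm]
  exact hc.mul_left_eq_zero

end FormalOModuleLaw

end Literature.RingTheory.FormalGroups
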